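import Summits.BirchSwinnertonDyer.Rank1Residual.Additive.KatoDescentClosedBindersContra
import Summits.BirchSwinnertonDyer.BirchSwinnertonDyer.Theorems.KatoDescentKMCImpReading
import Literature.NumberTheory.EllipticCurves.Kato2004.IwasawaInvolutionTwistProofs
import HarnessLib

set_option autoImplicit false

/-!
# The v2 closed Kato descent binders `(IsKatoZetaDescentDatumOf, KatoMainConjectureFine)` versus their
# PRINT-EXACT contragredient twins `(IsKatoZetaDescentDatumOfContra, KatoMainConjectureFineContra)`:
# the exact residual is ONE displayed `ι`-symmetry clause; and the `→`-only reading DISCHARGED at the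
# contragredient pair (cell `bsd-cm`, seat `bsd-cm-prr-ty1` g6, CONVENTION Q of planner D401/D403/D410; namespace
# `Summit.BirchSwinnertonDyer.Rank1Residual.Additive.ContraBridge`; theorems only; no route (`Theses`) file imported;
# nothing asserted, no item closed)

WHY THIS FILE. `Rank1Residual/Additive/KatoDescentClosedBinders.lean` (v2, p612876) keys the dual fine Selmer
group by the topological generator `γ` — the CONSTRUCTED datum `W.fineSelmerDualData K hγ`, on which `1 + T` acts
as `x ↦ x ∘ conj_γ`, i.e. `(X₀)^ι` — while `I : Kato2004.IwasawaH1Data W p K γ` carries Kato's covariant structure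
(`1 + T ↦ γ_*`). `Rank1Residual/Additive/KatoDescentClosedBindersContra.lean` (v3, this seat) keys it `γ⁻¹`
(`Y : W.FineSelmerDualData K γ⁻¹`, the CONTRAGREDIENT `X₀` = the `Λ`-structure Poitou–Tate duality carries Kato's
`𝐇²(T_pW)₀` to), which is Kato's Conj. 12.10 verbatim. This file PROVES how the two pairs are related, from the
Literature theorem `Kato2004.fineSelmerDualData_lengthAt_inv_eq` (p626559: `ℓ_𝔮(Y_{γ⁻¹}) = ℓ_{ι𝔮}(Y_γ)`,
`ι𝔮 = PrimeSpectrum.comap (IwasawaAlgebra.invol p) 𝔮`):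

* §1 `katoMainConjectureFineContra_iff_comap_invol` — **the contragredient `KMC` is the v2 SHAPE with `ι𝔮` on the
  `X₀` side**: `KatoMainConjectureFineContra W p ↔ ∀ hp, (∃ admissible) ∧ ∀ (K, γ, hγ, I, z₀ admissible) 𝔮 of height 1,
  ℓ_{ι𝔮}((W.fineSelmerDualData K hγ).X) = ℓ_𝔮(I.H/Λz₀)`; and the twin statement for `IsKatoZetaDescentDatumOfContra`
  (`isKatoZetaDescentDatumOfContra_iff_comap_invol`).
* §2 **the exact residual**: under the DISPLAYED hypothesis «`char_Λ X₀(ℚ_∞)` is `ι`-symmetric prime by prime»,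
  spelled `∀ (K, γ, hγ) 𝔮 of height 1, ℓ_𝔮((W.fineSelmerDualData K hγ).X) = ℓ_{ι𝔮}((W.fineSelmerDualData K hγ).X)`
  (UNPRINTED — Greenberg 1989 Thm. 2 pairs the fine condition with the relaxed one under `ι`), the two pairs are
  EQUIVALENT: `katoMainConjectureFine_iff_contra_of_involSymmetric`,
  `isKatoZetaDescentDatumOf_iff_contra_of_involSymmetric`. So «v2 stub 2 = Kato 12.10 ∧ that clause», numbers not
  adjectives.
* §3 **the `→`-only reading at the CONTRAGREDIENT pair is a kernel theorem** in the binder shape of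
  `KatoDescentKMCImpReading` (`conj1210_of_isOfContra_of_kmcFineContra`), and the closed-triple descent
  `rankOne_bsdp_of_kmcFineContra_of_perrinRiouRatio` (k7r-c4's generic `rankOne_bsdp_of_kmcImp_of_perrinRiou`
  instantiated at `(IsKatoZetaDescentDatumOfContra, Kato2004.PRRatio, KatoMainConjectureFineContra)`). The crux
  compositions for 19945 / 19223 at the contragredient triple are then THREE-LINE TERMS over k7r-c4's generic records:
  `ValueOfKMCImpReading.valueSevenOfGZK_of_kmcImp_of_perrinRiou hC hreal conj1210_of_isOfContra_of_kmcFineContra hmod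
  hCassels hKMC hPR` resp. `CccOneKMCImpReading.cccOneLawOnTypeIstarZero_of_kmcImp_of_perrinRiou hC hreal
  conj1210_of_isOfContra_of_kmcFineContra hKMC hPR h₅ h₆` (hand-over files
  `pub/bsd-cm/bsd-cm-prr-ty1/g6/{RamifiedSevenEllipticUnitsValueOfKMCContra,InertBadSignedBranchesCccOneOfKMCContra}.lean`
  spell them out as `Theorems/` records for a prover row; `Summits/…/Theorems/` is prover-only, D-0016).

HONEST LABEL: theorems only; no definition, no named fact, no instance, no notation, no `sorry`; every statement of §3
is CONDITIONAL on displayed hypotheses (readings 1″♭ / 3♭ of cell bsd-potss at the contragredient pair, GZK,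
modularity, the two conjecture-grade inputs); nothing about Kato's Main Conjecture, Perrin-Riou's conjecture or BSD is
asserted; no item is closed; BSD is not proved for any curve.
[cite: Kato2004Asterisque, Conj. 12.10 (p. 224), §12.2 (p. 220), (14.9.1) (p. 239), §17.13 (17.13.1) (p. 279)]
[cite: Greenberg1989, §0 pp. 101–102 (S^ι) and Thm. 2] [cite: GreenbergLNM1716, §1 p. 60]
[cite: BurnsKuriharaSano2019, Thm. 7.6 (p. 29), Conj. 2.8 (ii) (p. 10)]
-/

noncomputable section

open scoped Classical

open WeierstrassCurve Field Literature.NumberTheory.EllipticCurves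
  Literature.NumberTheory.EllipticCurves.Rank1Residual
  Literature.NumberTheory.EllipticCurves.Rank1Residual.Typed
  Literature.NumberTheory.EllipticCurves.Kato2004 Literature.NumberTheory.EllipticCurves.IwasawaAlgebra
  Literature.NumberTheory.GaloisRepresentations
open Summit.BirchSwinnertonDyer.Rank1Residual
open Summit.BirchSwinnertonDyer.Rank1Residual.Additive
open Summit.BirchSwinnertonDyer.BirchSwinnertonDyer.Theorems.KatoDescentKMCImpReading
open Summit.BirchSwinnertonDyer.BirchSwinnertonDyer.Theorems.CongruentShaFreeCutKatoDescentDatumOfH2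

namespace Summit.BirchSwinnertonDyer.Rank1Residual.Additive.ContraBridge

/-! ## §1 The contragredient pair is the v2 shape read at `ι𝔮` on the `X₀` side -/

section Shape

variable {W : WeierstrassCurve ℚ} [W.IsElliptic] [W.IsGloballyMinimal] {p : ℕ}

/-- **`KatoMainConjectureFineContra W p` ⟺ the v2 formula with `ι𝔮` on the `X₀` side**: for every prime structure,
(∃ admissible class) ∧ ∀ cyclotomic `(K, γ)` with `hγ`, pinned `I`, admissible `z₀`, height-one `𝔮`:
`ℓ_{ι𝔮}((W.fineSelmerDualData K hγ).X) = ℓ_𝔮(I.H/Λz₀)` — because any key-`γ⁻¹` datum `Y` has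
`ℓ_𝔮(Y.X) = ℓ_{ι𝔮}((W.fineSelmerDualData K hγ).X)` (`Kato2004.fineSelmerDualData_lengthAt_inv_eq`) and one exists
(`nonempty_fineSelmerDualData'`). [cite: Kato2004Asterisque, Conj. 12.10 (p. 224)] [cite: Greenberg1989, §0 pp. 101–102] -/
theorem katoMainConjectureFineContra_iff_comap_invol :
    KatoMainConjectureFineContra W p ↔
      ∀ hp : p.Prime,
        haveI : Fact p.Prime := ⟨hp⟩
        letI : ContinuousSMul ℤ_[p] (W.tateModule p) := TateModule.continuousSMul_padicInt
        (∃ (K : ZpExtension ℚ p) (hK : K.IsCyclotomic) (γ : absoluteGaloisGroup ℚ) (_ : K.IsTopGenerator γ)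
            (I : IwasawaH1Data W p K γ) (z₀ : I.H), Kato2004.IsAdmissibleZetaClass W p K hK I z₀) ∧
        ∀ (K : ZpExtension ℚ p) (hK : K.IsCyclotomic) (γ : absoluteGaloisGroup ℚ) (hγ : K.IsTopGenerator γ)
          (I : IwasawaH1Data W p K γ) (z₀ : I.H), Kato2004.IsAdmissibleZetaClass W p K hK I z₀ →
          ∀ 𝔮 : PrimeSpectrum (IwasawaAlgebra p), 𝔮.asIdeal.height = 1 →
            Module.lengthAt (IwasawaAlgebra p) (W.fineSelmerDualData K hγ).X
                (PrimeSpectrum.comap (IwasawaAlgebra.invol p).toRingHom 𝔮) =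
              Module.lengthAt (IwasawaAlgebra p) (I.H ⧸ (IwasawaAlgebra p) ∙ z₀) 𝔮 := by
  refine forall_congr' fun hp ↦ ?_
  haveI : Fact p.Prime := ⟨hp⟩
  refine and_congr Iff.rfl (forall₅_congr fun K hK γ hγ I ↦ forall₂_congr fun z₀ _ ↦ ?_)
  constructor
  · intro h 𝔮 h𝔮
    obtain ⟨Y⟩ := W.nonempty_fineSelmerDualData' K γ⁻¹
    rw [← Kato2004.fineSelmerDualData_lengthAt_inv_eq (W.fineSelmerDualData K hγ) Y 𝔮]
    exact h Y 𝔮 h𝔮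
  · intro h Y 𝔮 h𝔮
    rw [Kato2004.fineSelmerDualData_lengthAt_inv_eq (W.fineSelmerDualData K hγ) Y 𝔮]
    exact h 𝔮 h𝔮

variable [Fact p.Prime] {D : KatoDescentDatum p}

/-- **`IsKatoZetaDescentDatumOfContra W p D` ⟺ the v2 (H2) formula with `ι𝔮` on the `X₀` side**: a pin `P`,
admissibility, and `ℓ_𝔮(P.J.H2) = ℓ_{ι𝔮}((W.fineSelmerDualData P.κ P.isTopGenerator).X)` at every height-one `𝔮`.
[cite: Kato2004Asterisque, §14.14 (14.14.1) (p. 243), (14.9.1) (p. 239)] [cite: Greenberg1989, §0 pp. 101–102] -/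
theorem isKatoZetaDescentDatumOfContra_iff_comap_invol :
    IsKatoZetaDescentDatumOfContra W p D ↔
      letI : ContinuousSMul ℤ_[p] (W.tateModule p) := TateModule.continuousSMul_padicInt
      ∃ P : KatoDescentDatumPinH2 W p D,
        Kato2004.IsAdmissibleZetaClass W p P.κ P.isCyclotomic P.I (P.eH D.z) ∧
        ∀ 𝔮 : PrimeSpectrum (IwasawaAlgebra p), 𝔮.asIdeal.height = 1 →
          Module.lengthAt (IwasawaAlgebra p) P.J.H2 𝔮 =
            Module.lengthAt (IwasawaAlgebra p) (W.fineSelmerDualData P.κ P.isTopGenerator).X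
              (PrimeSpectrum.comap (IwasawaAlgebra.invol p).toRingHom 𝔮) := by
  letI : ContinuousSMul ℤ_[p] (W.tateModule p) := TateModule.continuousSMul_padicInt
  refine exists_congr fun P ↦ and_congr Iff.rfl ?_
  constructor
  · intro h 𝔮 h𝔮
    obtain ⟨Y⟩ := W.nonempty_fineSelmerDualData' P.κ P.γ⁻¹
    rw [← Kato2004.fineSelmerDualData_lengthAt_inv_eq (W.fineSelmerDualData P.κ P.isTopGenerator) Y 𝔮]
    exact h Y 𝔮 h𝔮
  · intro h Y 𝔮 h𝔮
    rw [Kato2004.fineSelmerDualData_lengthAt_inv_eq (W.fineSelmerDualData P.κ P.isTopGenerator) Y 𝔮]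
    exact h 𝔮 h𝔮

end Shape

/-! ## §2 The exact residual between the two pairs: ONE displayed `ι`-symmetry clause -/

section Residual

variable {W : WeierstrassCurve ℚ} [W.IsElliptic] [W.IsGloballyMinimal] {p : ℕ}

/-- **Under the DISPLAYED `ι`-symmetry of the height-one lengths of `X₀(ℚ_∞)` (UNPRINTED), the v2 closed `KMC`
and its contragredient twin are EQUIVALENT.** The hypothesis reads: for every prime structure, cyclotomic `(K, γ)`
with `hγ` and height-one `𝔮`, `ℓ_𝔮((W.fineSelmerDualData K hγ).X) = ℓ_{ι𝔮}((W.fineSelmerDualData K hγ).X)` —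
equivalently `char_Λ X₀(ℚ_∞) = ι(char_Λ X₀(ℚ_∞))`. This is the precise sense in which the v2 statement is
«Kato's Conj. 12.10 ∘ ι»: modulo this clause, and only modulo it, the two typings agree.
[cite: Kato2004Asterisque, Conj. 12.10 (p. 224)] [cite: Greenberg1989, §0 pp. 101–102 and Thm. 2] -/
theorem katoMainConjectureFine_iff_contra_of_involSymmetric
    (hsym : ∀ hp : p.Prime,
      haveI : Fact p.Prime := ⟨hp⟩
      ∀ (K : ZpExtension ℚ p) (_ : K.IsCyclotomic) (γ : absoluteGaloisGroup ℚ) (hγ : K.IsTopGenerator γ)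
        (𝔮 : PrimeSpectrum (IwasawaAlgebra p)), 𝔮.asIdeal.height = 1 →
        Module.lengthAt (IwasawaAlgebra p) (W.fineSelmerDualData K hγ).X 𝔮 =
          Module.lengthAt (IwasawaAlgebra p) (W.fineSelmerDualData K hγ).X
            (PrimeSpectrum.comap (IwasawaAlgebra.invol p).toRingHom 𝔮)) :
    KatoMainConjectureFine W p ↔ KatoMainConjectureFineContra W p := by
  rw [katoMainConjectureFineContra_iff_comap_invol]
  refine forall_congr' fun hp ↦ ?_
  haveI : Fact p.Prime := ⟨hp⟩
  refine and_congr Iff.rfl (forall₅_congr fun K hK γ hγ I ↦ forall₂_congr fun z₀ _ ↦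
    forall₂_congr fun 𝔮 h𝔮 ↦ ?_)
  rw [hsym hp K hK γ hγ 𝔮 h𝔮]

variable [Fact p.Prime] {D : KatoDescentDatum p}

/-- **Under the same displayed `ι`-symmetry (for the prime structure at hand), the v2 closed `IsOf` and its
contragredient twin agree on every datum.** [cite: Kato2004Asterisque, §14.14 (14.14.1) (p. 243)]
[cite: Greenberg1989, §0 pp. 101–102 and Thm. 2] -/
theorem isKatoZetaDescentDatumOf_iff_contra_of_involSymmetric
    (hsym : ∀ (K : ZpExtension ℚ p) (_ : K.IsCyclotomic) (γ : absoluteGaloisGroup ℚ) (hγ : K.IsTopGenerator γ)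
      (𝔮 : PrimeSpectrum (IwasawaAlgebra p)), 𝔮.asIdeal.height = 1 →
      Module.lengthAt (IwasawaAlgebra p) (W.fineSelmerDualData K hγ).X 𝔮 =
        Module.lengthAt (IwasawaAlgebra p) (W.fineSelmerDualData K hγ).X
          (PrimeSpectrum.comap (IwasawaAlgebra.invol p).toRingHom 𝔮)) :
    IsKatoZetaDescentDatumOf W p D ↔ IsKatoZetaDescentDatumOfContra W p D := by
  letI : ContinuousSMul ℤ_[p] (W.tateModule p) := TateModule.continuousSMul_padicInt
  rw [isKatoZetaDescentDatumOf_iff, isKatoZetaDescentDatumOfContra_iff_comap_invol]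
  refine exists_congr fun P ↦ and_congr Iff.rfl (forall₂_congr fun 𝔮 h𝔮 ↦ ?_)
  rw [hsym P.κ P.isCyclotomic P.γ P.isTopGenerator 𝔮 h𝔮]

end Residual

/-! ## §3 The (H2ᶜ) clause is realizable from the named fact p624791 (pin shape), and the `→`-only reading
DISCHARGED at the contragredient pair; the closed-triple descent -/

section Closed

/-- **(H2ᶜ) in PIN SHAPE from the named fact `Kato2004.exists_iwasawaH2Data_fineSelmerDual_embedding` (p624791)**:
under that fact (displayed as `h`), for `p ≠ 2`, `κ` cyclotomic with topological generator `γ`, `v` the place at `p`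
and `W(ℚ_{p,∞})[p^∞]` finite, every pinned `I : IwasawaH1Data W p κ γ` admits a package `J : IwasawaH2Data W p κ γ I`
with `ℓ_𝔮(J.H2) = ℓ_𝔮(Y.X)` for EVERY dual fine Selmer datum `Y` of key `γ⁻¹` and every height-one `𝔮` — exactly the
(H2ᶜ) clause of `IsKatoZetaDescentDatumOfContra` with `P.J := J` (Literature `….lengthAt_eq_contra`, p626559, for one
`Y`, then `forall_fineSelmerDualData_lengthAt_iff`). The remaining inputs of the stub-4 assembly
(`TorsionFree.RealizableOfKMC IsKatoZetaDescentDatumOfContra KatoMainConjectureFineContra`) are unchanged: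
`nonempty_iwasawaH1Data`, the ∃-conjunct of `KatoMainConjectureFineContra`, `IsAdmissibleZetaClass.ne_zero_of_rohrlich`,
`Kato2004.thm12_4`. [cite: Kato2004Asterisque, (14.9.1) (p. 239), §12.2 (12.2.3) (p. 220), (14.14.1) (p. 243), (17.13.1) (p. 279)] -/
theorem exists_iwasawaH2Data_lengthAt_eq_forall_fineSelmerDualData_inv
    (h : Kato2004.exists_iwasawaH2Data_fineSelmerDual_embedding)
    {W : WeierstrassCurve ℚ} [W.IsElliptic] {p : ℕ} [Fact p.Prime] [ContinuousSMul ℤ_[p] (W.tateModule p)]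
    {κ : ZpExtension ℚ p} {γ : absoluteGaloisGroup ℚ} (hγ : κ.IsTopGenerator γ)
    (v : IsDedekindDomain.HeightOneSpectrum (NumberField.RingOfIntegers ℚ)) (hp : p ≠ 2) (hκ : κ.IsCyclotomic)
    (hv : ((Rat.HeightOneSpectrum.primesEquiv v : Nat.Primes) : ℕ) = p)
    (hfin : Finite (FixedPoints.addSubgroup ↥(κ.kerSubgroup ⊓ GreenbergSelmer.decomp v) (W.geomPrimaryTorsion p)))
    (I : Kato2004.IwasawaH1Data W p κ γ) :
    ∃ J : Kato2004.IwasawaH2Data W p κ γ I,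
      ∀ (Y : W.FineSelmerDualData κ γ⁻¹) (𝔮 : PrimeSpectrum (IwasawaAlgebra p)), 𝔮.asIdeal.height = 1 →
        Module.lengthAt (IwasawaAlgebra p) J.H2 𝔮 = Module.lengthAt (IwasawaAlgebra p) Y.X 𝔮 := by
  obtain ⟨Y₀⟩ := W.nonempty_fineSelmerDualData' κ γ⁻¹
  obtain ⟨J, hJ⟩ := h.lengthAt_eq_contra hγ v hp hκ hv hfin I Y₀
  exact ⟨J, (forall_fineSelmerDualData_lengthAt_iff Y₀ _).mpr hJ⟩

/-- **The `→`-only reading at the CONTRAGREDIENT closed binders is a KERNEL THEOREM** (binder shape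
`∀ W p D, IsOf W p D → KMC W p → D.Conj1210` at `(IsOf, KMC) := (IsKatoZetaDescentDatumOfContra,
KatoMainConjectureFineContra)`; `conj1210_of_isKatoZetaDescentDatumOfContra_of_katoMainConjectureFineContra`).
[cite: Kato2004Asterisque, Conj. 12.10 (p. 224)] -/
theorem conj1210_of_isOfContra_of_kmcFineContra :
    ∀ (W : WeierstrassCurve ℚ) [W.IsElliptic] [W.IsGloballyMinimal] (p : ℕ) [Fact p.Prime]
      (D : KatoDescentDatum p), IsKatoZetaDescentDatumOfContra W p D → KatoMainConjectureFineContra W p →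
      D.Conj1210 :=
  fun _ _ _ _ _ _ hDof hKMC ↦ conj1210_of_isKatoZetaDescentDatumOfContra_of_katoMainConjectureFineContra hDof hKMC

/-- **Rank ONE at a torsion-free member, CONTRAGREDIENT CLOSED TRIPLE: `KatoMainConjectureFineContra W p →
PerrinRiouUpToUnitAt Kato2004.PRRatio W p → BSD(W, p)`** over the image-free readings 1″♭ / 3♭ of cell bsd-potss at
`(IsKatoZetaDescentDatumOfContra, Kato2004.PRRatio, KatoMainConjectureFineContra)`, GZK and modularity — k7r-c4's
generic `rankOne_bsdp_of_kmcImp_of_perrinRiou` with the reading discharged by `conj1210_of_isOfContra_of_kmcFineContra`.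
CONDITIONAL on the two readings, GZK, modularity and the two conjecture-grade inputs at the pair; nothing booked.
[cite: BurnsKuriharaSano2019, Thm. 7.6 (p. 29), Conj. 2.8 (ii) (p. 10)] [cite: Kato2004Asterisque, Conj. 12.10 (p. 224)]
[cite: Miller2011LMS, §1 and Def. 1.1] -/
theorem rankOne_bsdp_of_kmcFineContra_of_perrinRiouRatio
    (hC : TorsionFree.RankOneCountReading IsKatoZetaDescentDatumOfContra Kato2004.PRRatio)
    (hreal : TorsionFree.RealizableOfKMC IsKatoZetaDescentDatumOfContra KatoMainConjectureFineContra)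
    (hGZK : rank_eq_analyticRank_of_analyticRank_le_one) (hmod : hasEntireLFunction_rat)
    (W : WeierstrassCurve ℚ) [W.IsElliptic] [W.IsGloballyMinimal] (p : ℕ) [Fact p.Prime]
    (hr : W.analyticRank = 1) (hp : p ≠ 2) (hadd : Addv W p) (hj : 0 ≤ padicValRat p W.j)
    (ht : ¬ p ∣ W.torsionOrder) (hPR : PerrinRiouUpToUnitAt Kato2004.PRRatio W p)
    (hKMC : KatoMainConjectureFineContra W p) : BSDp W p :=
  rankOne_bsdp_of_kmcImp_of_perrinRiou W p hC hreal conj1210_of_isOfContra_of_kmcFineContra hGZK hmod hr hp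
    hadd hj ht hPR hKMC

/-- **Rank `0`, CONTRAGREDIENT CLOSED PAIR: `KatoMainConjectureFineContra W p → MissingPPartAt W p`** at a
torsion-free additive potentially good `p ≠ 2` over reading 1♭ / 3♭ (k7r-c4's generic
`missingPPartAt_rankZero_of_kmcImp`). CONDITIONAL; nothing booked. [cite: Kato2004Asterisque, Conj. 12.10 (p. 224), §14.14 (p. 243)] -/
theorem missingPPartAt_rankZero_of_kmcFineContra
    (hR : TorsionFree.DescentCountReading IsKatoZetaDescentDatumOfContra)
    (hreal : TorsionFree.RealizableOfKMC IsKatoZetaDescentDatumOfContra KatoMainConjectureFineContra)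
    (hGZK : rank_eq_analyticRank_of_analyticRank_le_one) (hmod : hasEntireLFunction_rat)
    (W : WeierstrassCurve ℚ) [W.IsElliptic] [W.IsGloballyMinimal] (p : ℕ) [Fact p.Prime]
    (hr : W.analyticRank = 0) (hp : p ≠ 2) (hadd : Addv W p) (hj : 0 ≤ padicValRat p W.j)
    (ht : ¬ p ∣ W.torsionOrder) (hKMC : KatoMainConjectureFineContra W p) : MissingPPartAt W p :=
  missingPPartAt_rankZero_of_kmcImp W p hR hreal conj1210_of_isOfContra_of_kmcFineContra hGZK hmod hr hp hadd hj
    ht hKMC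

end Closed

end Summit.BirchSwinnertonDyer.Rank1Residual.Additive.ContraBridge

end
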